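import Mathlib
import Literature.Probability.Process.BrownianIncrementGaussFunctional
import HarnessLib

/-!
# `tame_rigidity` is false, II: the two-mouth lake — frontier and solidity of the winding interior

Crux `Summit.CriticalPhenomena.CardyFormulaZ2.Theses.CardyMagicRigidity.NestingRigidity`
(stmt-CriticalPhenomena-4835), line `positive-cone-weight-doubling`, refutation of the registered helper
`tame_rigidity` (second brick; companion of `…TameRigidityArcs`, p131776).  Pure plane geometry of the winding
interior of the two-mouth-lake loop,

  `G = {z | |z| < 2 ∧ |z + 1| > 1 ∧ |z − 1| > 1}`   (the disc `B(0,2)` minus the two closed lakes `B̄(∓1,1)`),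

whose frontier is the trace `T = ∂B(0,2) ∪ ∂B(−1,1) ∪ ∂B(1,1)` (`TwoMouth.frontier_interior`, the `Tame.boundary`
clause; anchor `frontier_twoMouth`) and which is SOLID, `interior (G ∪ T) = G` (`TwoMouth.interior_union`, the
`Tame.solid` clause): `G ∪ T = {|z| ≤ 2 ∧ |z + 1| ≥ 1 ∧ |z − 1| ≥ 1}`.  The only delicate point is
`T ⊆ closure G` at the three tangency points `−2, 0, 2` (cusps), done with the explicit interior points `εi → 0`
and `±(2 − s) + i√(3s) → ±2`; elsewhere `V ∩ closure B ⊆ closure (V ∩ B)` for open `V`.  Everything is reduced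
to real polynomial (in)equalities in `re z`, `im z`.
-/

noncomputable section

open Set Metric Complex Filter Topology

namespace Summit.CriticalPhenomena.CardyFormulaZ2.Cruxes.NestingRigidity.PositiveConeWeightDoubling

open Literature.Probability.Process (norm_sq_eq_re_sq_add_im_sq)

namespace TwoMouth

/-! ## §1 Norms in coordinates -/

/-- `‖z‖ < 2 ↔ re² + im² < 4`. -/
theorem norm_lt_two_iff (z : ℂ) : ‖z‖ < 2 ↔ z.re ^ 2 + z.im ^ 2 < 4 := by
  rw [← norm_sq_eq_re_sq_add_im_sq, show (4 : ℝ) = 2 ^ 2 by norm_num, sq_lt_sq₀ (norm_nonneg _) zero_le_two]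

/-- `‖z‖ ≤ 2 ↔ re² + im² ≤ 4`. -/
theorem norm_le_two_iff (z : ℂ) : ‖z‖ ≤ 2 ↔ z.re ^ 2 + z.im ^ 2 ≤ 4 := by
  rw [← norm_sq_eq_re_sq_add_im_sq, show (4 : ℝ) = 2 ^ 2 by norm_num, sq_le_sq₀ (norm_nonneg _) zero_le_two]

/-- `‖z‖ = 2 ↔ re² + im² = 4`. -/
theorem norm_eq_two_iff (z : ℂ) : ‖z‖ = 2 ↔ z.re ^ 2 + z.im ^ 2 = 4 := by
  rw [← norm_sq_eq_re_sq_add_im_sq, show (4 : ℝ) = 2 ^ 2 by norm_num]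
  exact ⟨fun h ↦ by rw [h], fun h ↦ (sq_eq_sq₀ (norm_nonneg _) zero_le_two).1 h⟩

/-- `1 < ‖w‖ ↔ 1 < re² + im²`. -/
theorem one_lt_norm_iff (w : ℂ) : 1 < ‖w‖ ↔ 1 < w.re ^ 2 + w.im ^ 2 := by
  rw [← one_lt_sq_iff₀ (norm_nonneg _), norm_sq_eq_re_sq_add_im_sq]

/-- `1 ≤ ‖w‖ ↔ 1 ≤ re² + im²`. -/
theorem one_le_norm_iff (w : ℂ) : 1 ≤ ‖w‖ ↔ 1 ≤ w.re ^ 2 + w.im ^ 2 := by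
  rw [← one_le_sq_iff₀ (norm_nonneg _), norm_sq_eq_re_sq_add_im_sq]

/-- `‖w‖ = 1 ↔ re² + im² = 1`. -/
theorem norm_eq_one_iff' (w : ℂ) : ‖w‖ = 1 ↔ w.re ^ 2 + w.im ^ 2 = 1 := by
  rw [← norm_sq_eq_re_sq_add_im_sq]
  constructor
  · intro h; rw [h, one_pow]
  · intro h
    have := (sq_eq_sq₀ (norm_nonneg w) zero_le_one).1 (by rw [h, one_pow])
    exact this

/-! ## §2 The winding interior `G`, the trace `T`, and `G ∪ T` -/

/-- Membership in the trace `T` (union of the three circles) in terms of norms. -/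
theorem mem_trace_iff (z : ℂ) : z ∈ sphere (0 : ℂ) 2 ∪ sphere (-1) 1 ∪ sphere 1 1 ↔
    ‖z‖ = 2 ∨ ‖z + 1‖ = 1 ∨ ‖z - 1‖ = 1 := by
  simp only [mem_union, mem_sphere, dist_eq_norm, sub_zero, sub_neg_eq_add, or_assoc]

/-- `G` is open. -/
theorem isOpen_interior' : IsOpen {z : ℂ | ‖z‖ < 2 ∧ 1 < ‖z + 1‖ ∧ 1 < ‖z - 1‖} :=
  (isOpen_lt continuous_norm continuous_const).and
    ((isOpen_lt continuous_const (by fun_prop)).and (isOpen_lt continuous_const (by fun_prop)))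

/-- `G ∪ T = {|z| ≤ 2 ∧ |z + 1| ≥ 1 ∧ |z − 1| ≥ 1}`. -/
theorem union_trace_eq : {z : ℂ | ‖z‖ < 2 ∧ 1 < ‖z + 1‖ ∧ 1 < ‖z - 1‖} ∪
    (sphere (0 : ℂ) 2 ∪ sphere (-1) 1 ∪ sphere 1 1) = {z : ℂ | ‖z‖ ≤ 2 ∧ 1 ≤ ‖z + 1‖ ∧ 1 ≤ ‖z - 1‖} := by
  ext z
  rw [mem_union, mem_trace_iff]
  simp only [mem_setOf_eq, norm_lt_two_iff, one_lt_norm_iff, norm_le_two_iff, one_le_norm_iff,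
    norm_eq_two_iff, norm_eq_one_iff', add_re, add_im, one_re, one_im, sub_re, sub_im, add_zero, sub_zero]
  constructor
  · rintro (⟨h₁, h₂, h₃⟩ | h | h | h)
    · exact ⟨h₁.le, h₂.le, h₃.le⟩
    · refine ⟨h.le, ?_, ?_⟩ <;> nlinarith [sq_nonneg z.im, sq_nonneg (z.re + 2), sq_nonneg (z.re - 2)]
    · refine ⟨?_, h.ge, ?_⟩ <;> nlinarith [sq_nonneg z.im, sq_nonneg (z.re + 2), sq_nonneg z.re]
    · refine ⟨?_, ?_, h.ge⟩ <;> nlinarith [sq_nonneg z.im, sq_nonneg (z.re - 2), sq_nonneg z.re]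
  · rintro ⟨h₁, h₂, h₃⟩
    by_cases e₁ : z.re ^ 2 + z.im ^ 2 = 4
    · exact Or.inr (Or.inl e₁)
    by_cases e₂ : (z.re + 1) ^ 2 + z.im ^ 2 = 1
    · exact Or.inr (Or.inr (Or.inl e₂))
    by_cases e₃ : (z.re - 1) ^ 2 + z.im ^ 2 = 1
    · exact Or.inr (Or.inr (Or.inr e₃))
    exact Or.inl ⟨lt_of_le_of_ne h₁ e₁, lt_of_le_of_ne h₂ (Ne.symm e₂), lt_of_le_of_ne h₃ (Ne.symm e₃)⟩

/-- The trace misses `G`. -/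
theorem not_mem_of_mem_trace {z : ℂ} (hz : z ∈ sphere (0 : ℂ) 2 ∪ sphere (-1) 1 ∪ sphere 1 1) :
    z ∉ {z : ℂ | ‖z‖ < 2 ∧ 1 < ‖z + 1‖ ∧ 1 < ‖z - 1‖} := by
  rw [mem_trace_iff] at hz
  rintro ⟨h₁, h₂, h₃⟩
  rcases hz with h | h | h <;> linarith

/-- **Solidity**: `interior {|z| ≤ 2 ∧ |z + 1| ≥ 1 ∧ |z − 1| ≥ 1} = G`. -/
theorem interior_eq : interior {z : ℂ | ‖z‖ ≤ 2 ∧ 1 ≤ ‖z + 1‖ ∧ 1 ≤ ‖z - 1‖} =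
    {z : ℂ | ‖z‖ < 2 ∧ 1 < ‖z + 1‖ ∧ 1 < ‖z - 1‖} := by
  have hK : {z : ℂ | ‖z‖ ≤ 2 ∧ 1 ≤ ‖z + 1‖ ∧ 1 ≤ ‖z - 1‖} =
      closedBall (0 : ℂ) 2 ∩ ((ball (-1 : ℂ) 1)ᶜ ∩ (ball (1 : ℂ) 1)ᶜ) := by
    ext z; simp [dist_eq_norm, sub_neg_eq_add]
  have hG : {z : ℂ | ‖z‖ < 2 ∧ 1 < ‖z + 1‖ ∧ 1 < ‖z - 1‖} =
      ball (0 : ℂ) 2 ∩ ((closedBall (-1 : ℂ) 1)ᶜ ∩ (closedBall (1 : ℂ) 1)ᶜ) := by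
    ext z; simp [dist_eq_norm, sub_neg_eq_add]
  rw [hK, hG, interior_inter, interior_inter, interior_closedBall _ two_ne_zero, interior_compl,
    interior_compl, closure_ball _ one_ne_zero, closure_ball _ one_ne_zero]

/-! ## §3 `T ⊆ closure G`: cusps at `−2, 0, 2`, open-set trick elsewhere -/

/-- `0 ∈ closure G` (the points `εi`). -/
theorem zero_mem_closure : (0 : ℂ) ∈ closure {z : ℂ | ‖z‖ < 2 ∧ 1 < ‖z + 1‖ ∧ 1 < ‖z - 1‖} := by
  refine mem_closure_of_tendsto (f := fun ε : ℝ ↦ (ε : ℂ) * I) (b := 𝓝[>] (0 : ℝ)) ?_ ?_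
  · exact ((continuous_ofReal.mul continuous_const).tendsto' 0 0 (by simp)).mono_left nhdsWithin_le_nhds
  · filter_upwards [Ioo_mem_nhdsGT (zero_lt_one' ℝ)] with ε hε
    simp only [norm_lt_two_iff, one_lt_norm_iff, add_re, add_im, one_re, one_im, sub_re, sub_im, mul_re,
      mul_im, ofReal_re, ofReal_im, I_re, I_im]
    refine ⟨?_, ?_, ?_⟩ <;> nlinarith [hε.1, hε.2]

/-- `2 ∈ closure G` (the points `(2 − s) + i√(3s)` of the upper cell). -/
theorem two_mem_closure : (2 : ℂ) ∈ closure {z : ℂ | ‖z‖ < 2 ∧ 1 < ‖z + 1‖ ∧ 1 < ‖z - 1‖} := by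
  refine mem_closure_of_tendsto (f := fun s : ℝ ↦ ((2 - s : ℝ) : ℂ) + (Real.sqrt (3 * s) : ℂ) * I)
    (b := 𝓝[>] (0 : ℝ)) ?_ ?_
  · have hf : Continuous fun s : ℝ ↦ ((2 - s : ℝ) : ℂ) + (Real.sqrt (3 * s) : ℂ) * I := by fun_prop
    have := hf.tendsto 0
    simp only [sub_zero, mul_zero, Real.sqrt_zero, ofReal_zero, zero_mul, add_zero, ofReal_ofNat] at this
    exact this.mono_left nhdsWithin_le_nhds
  · filter_upwards [Ioo_mem_nhdsGT (zero_lt_one' ℝ)] with s hs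
    have h3 : Real.sqrt (3 * s) ^ 2 = 3 * s := Real.sq_sqrt (by linarith [hs.1])
    simp only [norm_lt_two_iff, one_lt_norm_iff, add_re, add_im, one_re, one_im, sub_re, sub_im, mul_re,
      mul_im, ofReal_re, ofReal_im, I_re, I_im]
    refine ⟨?_, ?_, ?_⟩ <;> nlinarith [hs.1, hs.2, h3]

/-- `−2 ∈ closure G` (the points `(s − 2) + i√(3s)`). -/
theorem neg_two_mem_closure : (-2 : ℂ) ∈ closure {z : ℂ | ‖z‖ < 2 ∧ 1 < ‖z + 1‖ ∧ 1 < ‖z - 1‖} := by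
  refine mem_closure_of_tendsto (f := fun s : ℝ ↦ ((s - 2 : ℝ) : ℂ) + (Real.sqrt (3 * s) : ℂ) * I)
    (b := 𝓝[>] (0 : ℝ)) ?_ ?_
  · have hf : Continuous fun s : ℝ ↦ ((s - 2 : ℝ) : ℂ) + (Real.sqrt (3 * s) : ℂ) * I := by fun_prop
    have := hf.tendsto 0
    simp only [zero_sub, mul_zero, Real.sqrt_zero, ofReal_zero, zero_mul, add_zero, ofReal_neg,
      ofReal_ofNat] at this
    exact this.mono_left nhdsWithin_le_nhds
  · filter_upwards [Ioo_mem_nhdsGT (zero_lt_one' ℝ)] with s hs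
    have h3 : Real.sqrt (3 * s) ^ 2 = 3 * s := Real.sq_sqrt (by linarith [hs.1])
    simp only [norm_lt_two_iff, one_lt_norm_iff, add_re, add_im, one_re, one_im, sub_re, sub_im, mul_re,
      mul_im, ofReal_re, ofReal_im, I_re, I_im]
    refine ⟨?_, ?_, ?_⟩ <;> nlinarith [hs.1, hs.2, h3]

/-- A point of `ℂ` with vanishing imaginary part and prescribed real part. -/
theorem eq_of_re_im {z : ℂ} {x : ℝ} (hre : z.re = x) (him : z.im = 0) : z = x :=
  Complex.ext (by simp [hre]) (by simp [him])

/-- Points of the big circle other than `±2` are in `closure G` (`V ∩ B̄(0,2) ⊆ closure (V ∩ B(0,2))`). -/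
theorem mem_closure_of_big {z : ℂ} (hz : ‖z‖ = 2) (h2 : z ≠ 2) (hm2 : z ≠ -2) :
    z ∈ closure {z : ℂ | ‖z‖ < 2 ∧ 1 < ‖z + 1‖ ∧ 1 < ‖z - 1‖} := by
  have hV : IsOpen {z : ℂ | 1 < ‖z + 1‖ ∧ 1 < ‖z - 1‖} :=
    (isOpen_lt continuous_const (by fun_prop)).and (isOpen_lt continuous_const (by fun_prop))
  have hG : {z : ℂ | ‖z‖ < 2 ∧ 1 < ‖z + 1‖ ∧ 1 < ‖z - 1‖} = {z : ℂ | 1 < ‖z + 1‖ ∧ 1 < ‖z - 1‖} ∩ ball 0 2 := by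
    ext w; simp only [mem_setOf_eq, mem_inter_iff, mem_ball, dist_zero_right]; tauto
  rw [hG]
  refine hV.inter_closure ⟨?_, by rw [closure_ball _ two_ne_zero, mem_closedBall, dist_zero_right, hz]⟩
  rw [norm_eq_two_iff] at hz
  have hre1 : -2 < z.re := by
    by_contra h
    have hre : z.re = -2 := by nlinarith [sq_nonneg z.im, sq_nonneg (z.re + 2)]
    have him : z.im = 0 := by nlinarith [sq_nonneg z.im]
    exact hm2 (by rw [eq_of_re_im hre him]; norm_num)
  have hre2 : z.re < 2 := by
    by_contra h
    have hre : z.re = 2 := by nlinarith [sq_nonneg z.im, sq_nonneg (z.re - 2)]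
    have him : z.im = 0 := by nlinarith [sq_nonneg z.im]
    exact h2 (by rw [eq_of_re_im hre him]; norm_num)
  simp only [mem_setOf_eq, one_lt_norm_iff, add_re, add_im, one_re, one_im, sub_re, sub_im, add_zero, sub_zero]
  constructor <;> nlinarith

/-- Points of the right lake boundary other than `0, 2` are in `closure G`. -/
theorem mem_closure_of_right {z : ℂ} (hz : ‖z - 1‖ = 1) (h2 : z ≠ 2) (h0 : z ≠ 0) :
    z ∈ closure {z : ℂ | ‖z‖ < 2 ∧ 1 < ‖z + 1‖ ∧ 1 < ‖z - 1‖} := by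
  have hS : IsOpen {z : ℂ | ‖z‖ < 2 ∧ 1 < ‖z + 1‖} :=
    (isOpen_lt continuous_norm continuous_const).and (isOpen_lt continuous_const (by fun_prop))
  have hG : {z : ℂ | ‖z‖ < 2 ∧ 1 < ‖z + 1‖ ∧ 1 < ‖z - 1‖} =
      {z : ℂ | ‖z‖ < 2 ∧ 1 < ‖z + 1‖} ∩ (closedBall (1 : ℂ) 1)ᶜ := by
    ext w; simp only [mem_setOf_eq, mem_inter_iff, mem_compl_iff, mem_closedBall, dist_eq_norm, not_le]; tauto
  rw [hG]
  refine hS.inter_closure ⟨?_, ?_⟩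
  · rw [norm_eq_one_iff', sub_re, sub_im, one_re, one_im, sub_zero] at hz
    have hre2 : z.re < 2 := by
      by_contra h
      have hre : z.re = 2 := by nlinarith [sq_nonneg z.im, sq_nonneg (z.re - 2)]
      have him : z.im = 0 := by nlinarith [sq_nonneg z.im]
      exact h2 (by rw [eq_of_re_im hre him]; norm_num)
    have hre0 : 0 < z.re := by
      by_contra h
      have hre : z.re = 0 := by nlinarith [sq_nonneg z.im, sq_nonneg z.re]
      have him : z.im = 0 := by nlinarith [sq_nonneg z.im]
      exact h0 (by rw [eq_of_re_im hre him]; norm_num)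
    simp only [mem_setOf_eq, norm_lt_two_iff, one_lt_norm_iff, add_re, add_im, one_re, one_im, add_zero]
    constructor <;> nlinarith
  · rw [closure_compl, interior_closedBall _ one_ne_zero, mem_compl_iff, mem_ball, dist_eq_norm, hz]
    exact lt_irrefl 1

/-- Points of the left lake boundary other than `0, −2` are in `closure G`. -/
theorem mem_closure_of_left {z : ℂ} (hz : ‖z + 1‖ = 1) (hm2 : z ≠ -2) (h0 : z ≠ 0) :
    z ∈ closure {z : ℂ | ‖z‖ < 2 ∧ 1 < ‖z + 1‖ ∧ 1 < ‖z - 1‖} := by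
  have hS : IsOpen {z : ℂ | ‖z‖ < 2 ∧ 1 < ‖z - 1‖} :=
    (isOpen_lt continuous_norm continuous_const).and (isOpen_lt continuous_const (by fun_prop))
  have hG : {z : ℂ | ‖z‖ < 2 ∧ 1 < ‖z + 1‖ ∧ 1 < ‖z - 1‖} =
      {z : ℂ | ‖z‖ < 2 ∧ 1 < ‖z - 1‖} ∩ (closedBall (-1 : ℂ) 1)ᶜ := by
    ext w
    simp only [mem_setOf_eq, mem_inter_iff, mem_compl_iff, mem_closedBall, dist_eq_norm, sub_neg_eq_add, not_le]
    tauto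
  rw [hG]
  refine hS.inter_closure ⟨?_, ?_⟩
  · rw [norm_eq_one_iff', add_re, add_im, one_re, one_im, add_zero] at hz
    have hre2 : -2 < z.re := by
      by_contra h
      have hre : z.re = -2 := by nlinarith [sq_nonneg z.im, sq_nonneg (z.re + 2)]
      have him : z.im = 0 := by nlinarith [sq_nonneg z.im]
      exact hm2 (by rw [eq_of_re_im hre him]; norm_num)
    have hre0 : z.re < 0 := by
      by_contra h
      have hre : z.re = 0 := by nlinarith [sq_nonneg z.im, sq_nonneg z.re]
      have him : z.im = 0 := by nlinarith [sq_nonneg z.im]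
      exact h0 (by rw [eq_of_re_im hre him]; norm_num)
    simp only [mem_setOf_eq, norm_lt_two_iff, one_lt_norm_iff, sub_re, sub_im, one_re, one_im, sub_zero]
    constructor <;> nlinarith
  · rw [closure_compl, interior_closedBall _ one_ne_zero, mem_compl_iff, mem_ball, dist_eq_norm,
      sub_neg_eq_add, hz]
    exact lt_irrefl 1

/-- **`T ⊆ closure G`.** -/
theorem trace_subset_closure : sphere (0 : ℂ) 2 ∪ sphere (-1) 1 ∪ sphere 1 1 ⊆
    closure {z : ℂ | ‖z‖ < 2 ∧ 1 < ‖z + 1‖ ∧ 1 < ‖z - 1‖} := by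
  intro z hz
  by_cases h2 : z = 2
  · subst h2; exact two_mem_closure
  by_cases hm2 : z = -2
  · subst hm2; exact neg_two_mem_closure
  by_cases h0 : z = 0
  · subst h0; exact zero_mem_closure
  rw [mem_trace_iff] at hz
  rcases hz with h | h | h
  exacts [mem_closure_of_big h h2 hm2, mem_closure_of_left h hm2 h0, mem_closure_of_right h h2 h0]

/-! ## §4 Frontier and solidity -/

/-- `closure G = G ∪ T`. -/
theorem closure_eq : closure {z : ℂ | ‖z‖ < 2 ∧ 1 < ‖z + 1‖ ∧ 1 < ‖z - 1‖} =
    {z : ℂ | ‖z‖ < 2 ∧ 1 < ‖z + 1‖ ∧ 1 < ‖z - 1‖} ∪ (sphere (0 : ℂ) 2 ∪ sphere (-1) 1 ∪ sphere 1 1) := by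
  refine Subset.antisymm ?_ (union_subset subset_closure trace_subset_closure)
  rw [union_trace_eq]
  refine closure_minimal (fun z ⟨h₁, h₂, h₃⟩ ↦ ⟨h₁.le, h₂.le, h₃.le⟩) ?_
  have e : {z : ℂ | ‖z‖ ≤ 2 ∧ 1 ≤ ‖z + 1‖ ∧ 1 ≤ ‖z - 1‖} =
      {z : ℂ | ‖z‖ ≤ 2} ∩ ({z : ℂ | 1 ≤ ‖z + 1‖} ∩ {z : ℂ | 1 ≤ ‖z - 1‖}) := rfl
  rw [e]
  exact (isClosed_le continuous_norm continuous_const).inter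
    ((isClosed_le continuous_const (continuous_norm.comp (continuous_id.add continuous_const))).inter
      (isClosed_le continuous_const (continuous_norm.comp (continuous_id.sub continuous_const))))

/-- **The frontier of the winding interior is the trace** (`Tame.boundary` for the two-mouth lake). -/
theorem frontier_interior : frontier {z : ℂ | ‖z‖ < 2 ∧ 1 < ‖z + 1‖ ∧ 1 < ‖z - 1‖} =
    sphere (0 : ℂ) 2 ∪ sphere (-1) 1 ∪ sphere 1 1 := by
  rw [frontier, isOpen_interior'.interior_eq, closure_eq]
  ext z
  constructor
  · rintro ⟨h | h, hn⟩
    exacts [absurd h hn, h]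
  · exact fun h ↦ ⟨Or.inr h, not_mem_of_mem_trace h⟩

/-- **Solidity** (`Tame.solid` for the two-mouth lake): `interior (G ∪ T) = G`. -/
theorem interior_union : interior ({z : ℂ | ‖z‖ < 2 ∧ 1 < ‖z + 1‖ ∧ 1 < ‖z - 1‖} ∪
    (sphere (0 : ℂ) 2 ∪ sphere (-1) 1 ∪ sphere 1 1)) = {z : ℂ | ‖z‖ < 2 ∧ 1 < ‖z + 1‖ ∧ 1 < ‖z - 1‖} := by
  rw [union_trace_eq, interior_eq]

end TwoMouth

/-- **Anchor (registered): the frontier of the two-mouth lake's winding interior is the union of the three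
circles** `|z| = 2`, `|z + 1| = 1`, `|z − 1| = 1` — the `Tame.boundary` clause of the witness refuting
`tame_rigidity` (with `TwoMouth.interior_union` for `Tame.solid`). -/
theorem frontier_twoMouth : frontier {z : ℂ | ‖z‖ < 2 ∧ 1 < ‖z + 1‖ ∧ 1 < ‖z - 1‖} =
    Metric.sphere 0 2 ∪ Metric.sphere (-1) 1 ∪ Metric.sphere 1 1 :=
  TwoMouth.frontier_interior

end Summit.CriticalPhenomena.CardyFormulaZ2.Cruxes.NestingRigidity.PositiveConeWeightDoubling

end
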